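import Summits.AnomalousDissipation.AnomalousDissipation.Theorems.MirrorVarietyTaylorGreenLoudGalerkinStatesStubTgForceRegular

/-!
# Negative knowledge for the crux `TaylorGreenLogLoudStates` (stmt-AnomalousDissipation-15060, route MirrorVariety), VI:
# the census stub of the picked line `Sketch` is milestone M1 in costume (junk one-dimensional coordinates)

Certified copy of the `-- Line Sketch / stub_census` section of the cdisprove work file
`Cruxes/TaylorGreenLogLoudStates/Disproof.lean` (refuter-cdisprove-stmt-AnomalousDissipation-15060-0). Supports
stmt-AnomalousDissipation-15060; no positive route-item statement is asserted; a small-model (junk-coordinates) fact about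
the line's registered stub `stub_census` and its lever `TwistedDegreeForcesBrokenZeros`.

The line (`Cruxes/TaylorGreenLogLoudStates/Lines/Sketch.lean`, card `half-turn-parity-forcing`) composes
`stub_divIdentityBox` (D1a, landed) + `stub_signedCountIdOutside` (D1b) + `stub_coerciveCutoff` (D2) ⇒ the lever
`TwistedDegreeForcesBrokenZeros` (Brouwer degree: a coercive `C¹` field whose `H`-fixed zeros are nondegenerate with signed
Jacobian count `≠ 1` has a zero off `Fix H`); lever + `stub_census : ∃ ν → 0⁺, GalerkinParityCensus ν` ⇒ milestone M1
(`HBrokenSteadyStatesExist`: K-symmetric, not H-symmetric steady Taylor–Green Galerkin states along `ν`); `stub_heart` ⇒ crux.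
`GalerkinParityCensus ν` asks, for every `j` and all large `N`, for SOME dimension `n`, SOME `C¹` coercive field `F` on `ℝⁿ`,
SOME linear involution `H`, the finite set `S` of `H`-fixed zeros (nondegenerate, signed count `≠ 1`) and SOME realisation
`e` of the zeros of `F` as admissible K-symmetric steady states under which field-`H`-symmetry forces `H c = c`. Nothing ties
`(n, F, H, e)` to the Galerkin map of the Taylor–Green system, so the census is satisfied by JUNK COORDINATES as soon as one
H-broken K-symmetric steady state `U` exists: `n = 1`, `F c = c − e₀`, `H = −id` (`Fix H = {0}`, so `S = ∅`, signed count
`0 ≠ 1`), `e ≡ U` (`parityCensusData_of_exists`). Conversely the lever turns census data into such a state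
(`exists_of_parityCensusData`). Hence, MODULO THE LEVER (true in print; Krasnosel'skiĭ–Zabreĭko 1984 §§1–3),
`stub_census ⟺ M1 along the same ν` (`parityCensus_iff_brokenStates`): the census stub as typed carries no
finite-dimensional / degree-theoretic content beyond M1 itself, the three analytic-degree stubs D1a, D1b, D2 are logically
idle in the composition `TaylorGreenLogLoudStates_of` (M1 ⇒ stub_census needs none of them), and the line's open content is
exactly M1 (existence of `τ`-aperiodic K-symmetric steady TG Galerkin states for all large `N` along some `ν_j → 0⁺`, see
`Negative/HalfTurn.lean` `isHSymm_iff_periodic`) followed by `stub_heart` (the crux restricted to that class). The intended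
census — the signed Jacobian count over ALL `H`-symmetric zeros of THE `K ∩ C₄`-Galerkin map at `(ν_j, N)` differs from `1`,
uniformly in `N` — is a different, stronger statement; if the lead wants the degree stubs to carry weight, `stub_census` must
name the Galerkin map (e.g. `F` conjugate under a linear isomorphism to `galerkinRHS` on the `K ∩ C₄`-fixed subspace, `e` that
isomorphism followed by the realisation of coefficient vectors, `H` the induced half-turn).

The census matrix is stated here over three abstract predicates `P₁ P₂ Q` (in the line: `P₁ = IsSteadyState (ν j) N tgForce`,
`P₂ = IsKSymm`, `Q = IsHSymm`), so that `ParityCensusData (IsSteadyState (ν j) N tgForce) IsKSymm IsHSymm` is DEFINITIONALLY the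
matrix of the line's `GalerkinParityCensus ν` at `(j, N)` and the lever below is verbatim the line's.
-/

noncomputable section

-- `Summit.<Summit>.<Problem>` is the tree's mandated summit-side namespace (CONVENTIONS §2); duplicate deliberate.
set_option linter.dupNamespace false

open scoped InnerProductSpace Topology BigOperators
open MeasureTheory Filter
open Literature.Analysis.FunctionSpaces Literature.Analysis.FunctionSpaces.Torus
open Summit.AnomalousDissipation.AnomalousDissipation.Theorems.TaylorGreenLoudGalerkinStates.Negative
open Summit.AnomalousDissipation.AnomalousDissipation.Theorems.TaylorGreenLoudGalerkinStates (IsKSymm)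

namespace Summit.AnomalousDissipation.AnomalousDissipation.Theorems.TaylorGreenLogLoudStates.Negative

/-- **The line's lever, verbatim** (`Lines/Sketch.lean` `TwistedDegreeForcesBrokenZeros`; Brouwer degree, TRUE in print —
Krasnosel'skiĭ–Zabreĭko 1984 §§1–3 — not yet in the tree): a coercive `C¹` self-map of `ℝⁿ` whose zeros in the fixed space of a
linear involution `H` form a finite set of nondegenerate zeros with signed Jacobian count `≠ 1` has a zero outside `Fix H`.
Used below only as a HYPOTHESIS. -/
def TwistedDegreeLever : Prop :=
  ∀ (n : ℕ) (F : EuclideanSpace ℝ (Fin n) → EuclideanSpace ℝ (Fin n))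
    (H : EuclideanSpace ℝ (Fin n) →L[ℝ] EuclideanSpace ℝ (Fin n)) (S : Finset (EuclideanSpace ℝ (Fin n))),
    (∀ c, H (H c) = c) → ContDiff ℝ 1 F →
    (∃ R : ℝ, 0 < R ∧ ∀ c, R ≤ ‖c‖ → 0 < ⟪F c, c⟫_ℝ) →
    (∀ c, c ∈ S ↔ (F c = 0 ∧ H c = c)) →
    (∀ c ∈ S, (fderiv ℝ F c).det ≠ 0) →
    (∑ c ∈ S, Real.sign ((fderiv ℝ F c).det)) ≠ 1 →
    ∃ c, F c = 0 ∧ H c ≠ c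

/-- **The census matrix at one `(j, N)`, over abstract predicates** (`P₁ = IsSteadyState (ν j) N tgForce`, `P₂ = IsKSymm`,
`Q = IsHSymm` give DEFINITIONALLY the matrix of the line's `GalerkinParityCensus ν`): some dimension, some coercive `C¹` field,
some linear involution, the finite set of its fixed zeros (nondegenerate, signed count `≠ 1`), and some realisation of the
zeros as `P₁ ∧ P₂` objects on which `Q` forces `H c = c`. -/
def ParityCensusData (P₁ P₂ Q : (UnitAddTorus (Fin 3) → EuclideanSpace ℝ (Fin 3)) → Prop) : Prop :=
  ∃ (n : ℕ) (F : EuclideanSpace ℝ (Fin n) → EuclideanSpace ℝ (Fin n))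
    (H : EuclideanSpace ℝ (Fin n) →L[ℝ] EuclideanSpace ℝ (Fin n)) (S : Finset (EuclideanSpace ℝ (Fin n)))
    (e : EuclideanSpace ℝ (Fin n) → UnitAddTorus (Fin 3) → EuclideanSpace ℝ (Fin 3)),
    (∀ c, H (H c) = c) ∧ ContDiff ℝ 1 F ∧
    (∃ R : ℝ, 0 < R ∧ ∀ c, R ≤ ‖c‖ → 0 < ⟪F c, c⟫_ℝ) ∧
    (∀ c, c ∈ S ↔ (F c = 0 ∧ H c = c)) ∧
    (∀ c ∈ S, (fderiv ℝ F c).det ≠ 0) ∧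
    (∑ c ∈ S, Real.sign ((fderiv ℝ F c).det)) ≠ 1 ∧
    (∀ c, F c = 0 → P₁ (e c) ∧ P₂ (e c) ∧ (Q (e c) → H c = c))

/-- **Junk coordinates: one broken object gives census data.** If some `U` has `P₁ U ∧ P₂ U ∧ ¬ Q U`, the census matrix holds
with `n = 1`, `F c = c − e₀`, `H = −id`, `S = ∅` (signed count `0 ≠ 1`), `e ≡ U` — no Galerkin map, no degree. [folklore] -/
theorem parityCensusData_of_exists {P₁ P₂ Q : (UnitAddTorus (Fin 3) → EuclideanSpace ℝ (Fin 3)) → Prop}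
    (h : ∃ U, P₁ U ∧ P₂ U ∧ ¬ Q U) : ParityCensusData P₁ P₂ Q := by
  obtain ⟨U, h1, h2, h3⟩ := h
  set v₀ : EuclideanSpace ℝ (Fin 1) := EuclideanSpace.single 0 1 with hv₀
  have hnorm : ‖v₀‖ = 1 := by
    rw [hv₀]
    simp
  have hv₀ne : v₀ ≠ 0 := by
    intro h0
    rw [h0, norm_zero] at hnorm
    exact zero_ne_one hnorm
  refine ⟨1, fun c => c - v₀, -ContinuousLinearMap.id ℝ _, ∅, fun _ => U, ?_, ?_, ?_, ?_, ?_, ?_, ?_⟩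
  · intro c
    simp
  · exact contDiff_id.sub contDiff_const
  · refine ⟨2, two_pos, fun c hc => ?_⟩
    rw [inner_sub_left, real_inner_self_eq_norm_sq]
    nlinarith [real_inner_le_norm v₀ c, hnorm]
  · intro c
    simp only [Finset.notMem_empty, false_iff, not_and]
    intro hc hH
    apply hv₀ne
    have hc' : c = v₀ := sub_eq_zero.1 hc
    have hH' : -c = c := by simpa using hH
    have h2c : c + c = 0 := by
      nth_rewrite 1 [← hH']
      exact neg_add_cancel c
    rw [← hc']
    have : (2 : ℝ) • c = 0 := by rw [two_smul]; exact h2c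
    exact (smul_eq_zero.1 this).resolve_left two_ne_zero
  · intro c hc
    simp at hc
  · rw [Finset.sum_empty]
    norm_num
  · intro c _
    exact ⟨h1, h2, fun hq => absurd hq h3⟩

/-- **The lever turns census data into a broken object** (the composition `hBroken_of_census` of the line, at one `(j, N)`).
[folklore] -/
theorem exists_of_parityCensusData (hlever : TwistedDegreeLever)
    {P₁ P₂ Q : (UnitAddTorus (Fin 3) → EuclideanSpace ℝ (Fin 3)) → Prop} (h : ParityCensusData P₁ P₂ Q) :
    ∃ U, P₁ U ∧ P₂ U ∧ ¬ Q U := by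
  obtain ⟨n, F, H, S, e, hHH, hF, hco, hS, hnd, hpar, hreal⟩ := h
  obtain ⟨c, hc0, hcH⟩ := hlever n F H S hHH hF hco hS hnd hpar
  obtain ⟨h1, h2, h3⟩ := hreal c hc0
  exact ⟨e c, h1, h2, fun hq => hcH (h3 hq)⟩

/-- **Modulo the lever, census data ⟺ one broken object.** [folklore] -/
theorem parityCensusData_iff (hlever : TwistedDegreeLever)
    (P₁ P₂ Q : (UnitAddTorus (Fin 3) → EuclideanSpace ℝ (Fin 3)) → Prop) :
    ParityCensusData P₁ P₂ Q ↔ ∃ U, P₁ U ∧ P₂ U ∧ ¬ Q U :=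
  ⟨exists_of_parityCensusData hlever, parityCensusData_of_exists⟩

/-- **`stub_census` is M1 in costume.** For any viscosity sequence `ν` and any symmetry predicate `Q` (the line's `IsHSymm`):
the Taylor–Green parity census along `ν` (`∀ j, ∀ᶠ N`, census data for admissible K-symmetric steady states at `(ν j, N)`) is
equivalent, MODULO the lever, to the bare existence of `Q`-broken K-symmetric steady Taylor–Green Galerkin states for every
`j` and all large `N` (the matrix of the line's M1 `HBrokenSteadyStatesExist`); the direction "states ⇒ census" needs no
lever and no degree theory. [folklore] -/
theorem parityCensus_iff_brokenStates (hlever : TwistedDegreeLever) (ν : ℕ → ℝ)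
    (Q : (UnitAddTorus (Fin 3) → EuclideanSpace ℝ (Fin 3)) → Prop) :
    (∀ j, ∀ᶠ N in atTop, ParityCensusData (IsSteadyState (ν j) N tgForce) IsKSymm Q) ↔
      ∀ j, ∀ᶠ N in atTop, ∃ U : UnitAddTorus (Fin 3) → EuclideanSpace ℝ (Fin 3),
        IsSteadyState (ν j) N tgForce U ∧ IsKSymm U ∧ ¬ Q U := by
  refine forall_congr' fun j => ⟨fun h => ?_, fun h => ?_⟩
  · exact h.mono fun N hN => exists_of_parityCensusData hlever hN
  · exact h.mono fun N hN => parityCensusData_of_exists hN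

/-- **States ⇒ census, lever-free** (the direction that makes D1a/D1b/D2 idle in the line's composition). [folklore] -/
theorem parityCensus_of_brokenStates (ν : ℕ → ℝ) (Q : (UnitAddTorus (Fin 3) → EuclideanSpace ℝ (Fin 3)) → Prop)
    (h : ∀ j, ∀ᶠ N in atTop, ∃ U : UnitAddTorus (Fin 3) → EuclideanSpace ℝ (Fin 3),
      IsSteadyState (ν j) N tgForce U ∧ IsKSymm U ∧ ¬ Q U) :
    ∀ j, ∀ᶠ N in atTop, ParityCensusData (IsSteadyState (ν j) N tgForce) IsKSymm Q :=
  fun j => (h j).mono fun _ hN => parityCensusData_of_exists hN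

end Summit.AnomalousDissipation.AnomalousDissipation.Theorems.TaylorGreenLogLoudStates.Negative

end
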